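import Summits.BirchSwinnertonDyer.Rank1Residual.ManinAdditive.CongruenceNumberTwistTwo
import Summits.BirchSwinnertonDyer.Rank1Residual.ManinAdditive.TwistOrbitAtTwoExactDegree
import Literature.NumberTheory.EllipticCurves.ComplexMultiplicationLFunctionIsogenyHoldsProofs
import HarnessLib

/-!
# TWIN AT TWO, part 4: E-desc-20 `TwistPacketCongruenceInvariance` PROVED on the PRIME-CONDUCTOR
# sub-packet `d ∈ {−1, 2, −2} ∪ {p* : p odd prime}`, `cond(χ_d)² ∣ N` — cell `bsd-f2-manin`
# (D-0131 (3) frontier: the Manin constant at additive primes), analytic lens (seat `-an`, g7, MEMO-an §51)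

THEOREMS ONLY (no definition, no named fact, no `sorry`; nothing booked; no census number moved; the
`@[conjecture]` node E-desc-20 itself — ALL `d`, no level hypothesis — is NOT discharged).

## What

* **`parametrization_f_eq_charTwist` (§1):** if `C = u • (W ⊗ d)` is isogenous to `W′`, `p² ∣ N`,
  `m² ∣ N`, `χ` primitive quadratic mod `m` with `aₙ(C) = χ(n) aₙ(W)` for `p ∤ n`, and `D, D′` are
  `ModularParametrizationData` of `W, W′` at the SAME level `N`, then `D′.f = D.f ⊗ χ` (coefficientwise;
  both sides vanish at `p ∣ n` by newform depletion; `IsIsogenous.LFunction_eq` = Faltings).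
* **Twin pairs up to isogeny (§1):** `congruenceNumber D.f = congruenceNumber D′.f` for
  `d = −1` & `2⁴ ∣ N` (`χ₋₄`), `d = ±2` & `2⁶ ∣ N` (`χ₈`, `χ₋₈`; TWIN AT TWO of
  `CongruenceNumberTwistTwo`), and `d = p* = (−1)^{(p−1)/2} p` & `p² ∣ N`, `p` odd (O5's
  `PrimeTwist.congruenceNumber_charTwist_of_isNewform0`, here extended from `C = W′` to `C ~ W′`).
* **E-desc-20 slices (§2), binders VERBATIM** from `CongruenceExcessCeilingLaws.TwistPacketCongruenceInvariance`
  (desc g7, p578659) plus the slice hypotheses: `twistPacketCongruenceInvariance_two_negOne` (`d = −1`,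
  `2⁴ ∣ N(W)`), `_two_two` / `_two_negTwo` (`d = ±2`, `2⁶ ∣ N(W)`), `_twoPart` (`d ∈ {−1, 2, −2}`,
  `2⁶ ∣ N(W)`), `_oddPrime` (`d = p*`, `p² ∣ N(W)`), and the union `_primeConductor`.
  CENSUS COVERAGE (cell census `TWISTCENSUS2-rows-v1` 43352cbe215eb58a, Cremona `N < 5·10⁵`, all
  same-conductor rows `N′ = N`): `d = −1` occurs only at `v₂(N) ∈ {5, 6, 7, 8}` (79 015 + 167 088 +
  35 404 + 15 696 rows), `d = ±2` only at `v₂(N) ∈ {7, 8}` (2 × (35 404 + 15 696)), odd `d = p*` only at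
  `v_p(N) ≥ 2` — so the slice hypotheses hold on 100 % of E-desc-20's prime-conductor census habitat, and
  desc's 707 / 707 (`d ∈ {−4, 8, −8}` at `16 ∣ N`: 444; `d = −3` at `27 ∣ N`: 269; the packet `d = −3`
  is `p* ` for `p = 3`) are now instances of theorems. Beyond print: ARS 2012 §2 sets up `r_E` only;
  the twist-invariance of `r_E` at conductor `4`, `8` is not in print (MEMO-desc §19.9, refuter-2 v7 §K⁷,
  MEMO-an §51 presearch).

## What this does NOT do

Composite `d` (products of prime conductors, where intermediate levels may differ), pairs with
`cond(χ_d)² ∤ N` (none in the census), and every Manin-constant statement are untouched; refuter-1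
§R32's caveat (the twist is not invertible on the integral Hecke module) is answered by NOT inverting
it: the isometry + `R² ≡ id (mod (ℤf)^⊥)` give the bijection of ARS quotients directly.

References: [AgasheRibetStein2012] §2.1; [Shimura1971] Prop. 3.64; [DiamondShurman2005] Prop. 5.5.2(a);
[AtkinLehner1970] Thm. 3; [Faltings1983Endlichkeit] §5 Kor. 2; [Knapp1993] Thm. 11.67.
-/

noncomputable section

open scoped MatrixGroups ModularForm

open CongruenceSubgroup Literature.NumberTheory.EllipticCurves.ModularForms
  Literature.NumberTheory.Automorphic Summit.BirchSwinnertonDyer.Rank1Residual.O5 WeierstrassCurve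

namespace Summit.BirchSwinnertonDyer.Rank1Residual.ManinAdditive

namespace TwistAtTwo

/-! ### §1 TWIN for parametrisation data of twin pairs up to isogeny -/

section Curves

/-- `χ₈(5) = −1` (through `Int.castRingHom ℂ`). [folklore] -/
theorem χ₈_ringHomComp_apply_five : (ZMod.χ₈.ringHomComp (Int.castRingHom ℂ)) 5 = -1 := by
  rw [MulChar.ringHomComp_apply]
  have h : ZMod.χ₈ (5 : ZMod 8) = -1 := by decide
  rw [h]
  simp

/-- `χ₋₈(5) = −1` (through `Int.castRingHom ℂ`). [folklore] -/
theorem χ₈'_ringHomComp_apply_five : (ZMod.χ₈'.ringHomComp (Int.castRingHom ℂ)) 5 = -1 := by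
  rw [MulChar.ringHomComp_apply]
  have h : ZMod.χ₈' (5 : ZMod 8) = -1 := by decide
  rw [h]
  simp

variable {N N' : ℕ} [NeZero N] [NeZero N']

/-- **The newform of a curve isogenous to `u • (W ⊗ χ)` is `D.f ⊗ χ`** (same level `N`, `m² ∣ N`,
`p² ∣ N`, `aₙ(C) = χ(n) aₙ(W)` for `p ∤ n`): coefficientwise (both sides vanish for `p ∣ n`).
[cite: Shimura1971, Prop. 3.64] [cite: AtkinLehner1970, Thm. 3] [cite: Faltings1983Endlichkeit, §5 Korollar 2] -/
theorem parametrization_f_eq_charTwist {p m : ℕ} [Fact p.Prime] [NeZero m] (hm : m ^ 2 ∣ N)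
    (hpN : p ^ 2 ∣ N) {χ : DirichletCharacter ℂ m} (hχ : χ.IsQuadratic) (hprim : χ.IsPrimitive)
    {W W' C : WeierstrassCurve ℚ} [W.IsElliptic] [W'.IsElliptic] [C.IsElliptic]
    (hCW : ∀ n : ℕ, ¬ p ∣ n → (C.LFunction n : ℂ) = χ n * W.LFunction n) (hiso : IsIsogenous C W')
    (D : ModularParametrizationData W N) (D' : ModularParametrizationData W' N) :
    D'.f = charTwist N dvd_rfl hm hχ D.f := by
  refine eq_of_forall_cuspCoeff_eq_gamma0 fun n ↦ ?_
  rw [cuspCoeff_charTwist N _ hm hχ hprim]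
  by_cases hn : p ∣ n
  · rw [PrimeTwist.cuspCoeff_eq_zero_of_prime_dvd_of_isNewform0 hpN D'.isNewformOf.1 hn,
      PrimeTwist.cuspCoeff_eq_zero_of_prime_dvd_of_isNewform0 hpN D.isNewformOf.1 hn, mul_zero]
  · rw [D'.isNewformOf.2 n, D.isNewformOf.2 n, ← hiso.LFunction_eq, hCW n hn]

/-- **TWIN for a `χ₋₄`-twin pair up to isogeny, `16 ∣ N`:** `C = u • (W ⊗ (−1))` isogenous to `W′`,
`D, D′` parametrisation data of `W, W′` at levels `N = N′` ⇒ `congruenceNumber D.f = congruenceNumber D′.f`.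
[cite: AgasheRibetStein2012, §2.1] [cite: Shimura1971, Prop. 3.64] -/
theorem congruenceNumber_twin_negOne {W W' C : WeierstrassCurve ℚ} [W.IsElliptic] [W'.IsElliptic]
    [C.IsElliptic] (hNN : N' = N) (h16 : 2 ^ 4 ∣ N) (u : VariableChange ℚ)
    (hC : u • W.quadraticTwist (((-1 : ℤ)) : ℚ) = C) (hiso : IsIsogenous C W')
    (D : ModularParametrizationData W N) (D' : ModularParametrizationData W' N') :
    congruenceNumber D.f = congruenceNumber D'.f := by
  subst hNN
  have h16' : 4 ^ 2 ∣ N' := by norm_num at h16 ⊢; exact h16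
  have h4 : 2 ^ 2 ∣ N' := (show 2 ^ 2 ∣ 2 ^ 4 by norm_num).trans h16
  haveI : (W.quadraticTwist (((-1 : ℤ)) : ℚ)).IsElliptic := W.isElliptic_quadraticTwist (by norm_num)
  have hCW : ∀ n : ℕ, ¬ 2 ∣ n →
      (C.LFunction n : ℂ) = (ZMod.χ₄.ringHomComp (Int.castRingHom ℂ)) n * W.LFunction n := by
    intro n hn
    rw [← hC, WeierstrassCurve.LFunction_smul, LFunction_quadraticTwist_negOne_intCast_of_odd W n hn,
      χ₄_ringHomComp_apply_natCast]
    push_cast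
    ring
  rw [parametrization_f_eq_charTwist h16' h4 isQuadratic_χ₄_ringHomComp isPrimitive_χ₄_ringHomComp hCW
    hiso D D', congruenceNumber_charTwist_four_of_isNewform0 h16' isQuadratic_χ₄_ringHomComp
    isPrimitive_χ₄_ringHomComp D.isNewformOf.1]

/-- **TWIN for a `χ₈`-twin pair up to isogeny, `64 ∣ N`** (`d = 2`). [cite: AgasheRibetStein2012, §2.1] -/
theorem congruenceNumber_twin_two {W W' C : WeierstrassCurve ℚ} [W.IsElliptic] [W'.IsElliptic]
    [C.IsElliptic] (hNN : N' = N) (h64 : 2 ^ 6 ∣ N) (u : VariableChange ℚ)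
    (hC : u • W.quadraticTwist (((2 : ℤ)) : ℚ) = C) (hiso : IsIsogenous C W')
    (D : ModularParametrizationData W N) (D' : ModularParametrizationData W' N') :
    congruenceNumber D.f = congruenceNumber D'.f := by
  subst hNN
  have h64' : 8 ^ 2 ∣ N' := by norm_num at h64 ⊢; exact h64
  have h4 : 2 ^ 2 ∣ N' := (show 2 ^ 2 ∣ 2 ^ 6 by norm_num).trans h64
  haveI : (W.quadraticTwist (((2 : ℤ)) : ℚ)).IsElliptic := W.isElliptic_quadraticTwist (by norm_num)
  have hCW : ∀ n : ℕ, ¬ 2 ∣ n →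
      (C.LFunction n : ℂ) = (ZMod.χ₈.ringHomComp (Int.castRingHom ℂ)) n * W.LFunction n := by
    intro n hn
    rw [← hC, WeierstrassCurve.LFunction_smul, LFunction_quadraticTwist_two_intCast_of_odd W n hn,
      χ₈_ringHomComp_apply_natCast]
    push_cast
    ring
  rw [parametrization_f_eq_charTwist h64' h4 isQuadratic_χ₈_ringHomComp isPrimitive_χ₈_ringHomComp hCW
    hiso D D', congruenceNumber_charTwist_eight_of_isNewform0 h64' isQuadratic_χ₈_ringHomComp
    isPrimitive_χ₈_ringHomComp χ₈_ringHomComp_apply_five D.isNewformOf.1]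

/-- **TWIN for a `χ₋₈`-twin pair up to isogeny, `64 ∣ N`** (`d = −2`). [cite: AgasheRibetStein2012, §2.1] -/
theorem congruenceNumber_twin_negTwo {W W' C : WeierstrassCurve ℚ} [W.IsElliptic] [W'.IsElliptic]
    [C.IsElliptic] (hNN : N' = N) (h64 : 2 ^ 6 ∣ N) (u : VariableChange ℚ)
    (hC : u • W.quadraticTwist (((-2 : ℤ)) : ℚ) = C) (hiso : IsIsogenous C W')
    (D : ModularParametrizationData W N) (D' : ModularParametrizationData W' N') :
    congruenceNumber D.f = congruenceNumber D'.f := by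
  subst hNN
  have h64' : 8 ^ 2 ∣ N' := by norm_num at h64 ⊢; exact h64
  have h4 : 2 ^ 2 ∣ N' := (show 2 ^ 2 ∣ 2 ^ 6 by norm_num).trans h64
  haveI : (W.quadraticTwist (((-2 : ℤ)) : ℚ)).IsElliptic := W.isElliptic_quadraticTwist (by norm_num)
  have hCW : ∀ n : ℕ, ¬ 2 ∣ n →
      (C.LFunction n : ℂ) = (ZMod.χ₈'.ringHomComp (Int.castRingHom ℂ)) n * W.LFunction n := by
    intro n hn
    rw [← hC, WeierstrassCurve.LFunction_smul, LFunction_quadraticTwist_negTwo_intCast_of_odd W n hn,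
      χ₈'_ringHomComp_apply_natCast]
    push_cast
    ring
  rw [parametrization_f_eq_charTwist h64' h4 isQuadratic_χ₈'_ringHomComp isPrimitive_χ₈'_ringHomComp hCW
    hiso D D', congruenceNumber_charTwist_eight_of_isNewform0 h64' isQuadratic_χ₈'_ringHomComp
    isPrimitive_χ₈'_ringHomComp χ₈'_ringHomComp_apply_five D.isNewformOf.1]

/-- **TWIN for a `p*`-twin pair up to isogeny, `p` odd, `p² ∣ N`** (`d = p* = (−1)^{(p−1)/2} p`; O5's
`PrimeTwist.congruenceNumber_twin_prime` extended from `C = W′` to `C ~ W′`).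
[cite: AgasheRibetStein2012, §2.1] [cite: Shimura1971, Prop. 3.64] -/
theorem congruenceNumber_twin_pStar {p : ℕ} [Fact p.Prime] (hp2 : p ≠ 2) {W W' C : WeierstrassCurve ℚ}
    [W.IsElliptic] [W'.IsElliptic] [C.IsElliptic] (hNN : N' = N) (hpN : p ^ 2 ∣ N) (u : VariableChange ℚ)
    (hC : u • W.quadraticTwist ((((-1 : ℤ) ^ (p / 2) * p : ℤ)) : ℚ) = C) (hiso : IsIsogenous C W')
    (D : ModularParametrizationData W N) (D' : ModularParametrizationData W' N') :
    congruenceNumber D.f = congruenceNumber D'.f := by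
  subst hNN
  have hχq := isQuadratic_quadraticChar_ringHomComp p
  have hprim := isPrimitive_quadraticChar_ringHomComp p hp2
  have hd0 : ((((-1 : ℤ) ^ (p / 2) * p : ℤ)) : ℚ) ≠ 0 := by
    push_cast
    exact mul_ne_zero (pow_ne_zero _ (by norm_num)) (by exact_mod_cast (Fact.out : p.Prime).ne_zero)
  haveI : (W.quadraticTwist ((((-1 : ℤ) ^ (p / 2) * p : ℤ)) : ℚ)).IsElliptic :=
    W.isElliptic_quadraticTwist hd0
  have hCW : ∀ n : ℕ, ¬ p ∣ n → (C.LFunction n : ℂ) =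
      (quadraticChar (ZMod p)).ringHomComp (Int.castRingHom ℂ) n * W.LFunction n := by
    intro n hn
    rw [← hC, WeierstrassCurve.LFunction_smul, W.LFunction_quadraticTwist_pStar_apply hp2 hn,
      quadraticChar_ringHomComp_apply_natCast]
    push_cast
    ring
  rw [parametrization_f_eq_charTwist hpN hpN hχq hprim hCW hiso D D',
    PrimeTwist.congruenceNumber_charTwist_of_isNewform0 hpN hχq hprim D.isNewformOf.1]

end Curves

/-! ### §2 The prime-conductor slices of E-desc-20 `TwistPacketCongruenceInvariance`, PROVED -/

section Slices

/-- **E-desc-20 at `d = −1`: PROVED under `2⁴ ∣ N(W)`** (binders verbatim from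
`CongruenceExcessCeilingLaws.TwistPacketCongruenceInvariance` at `d := −1`; the minimality binders are
unused). Census: every same-conductor `d = −1` row has `v₂(N) ≥ 5`. [cite: AgasheRibetStein2012, §2.1] -/
theorem twistPacketCongruenceInvariance_two_negOne :
    ∀ (W W' C : WeierstrassCurve ℚ) [W.IsElliptic] [W.IsGloballyMinimal] [W'.IsElliptic]
      [W'.IsGloballyMinimal] [C.IsElliptic] [NeZero (W.conductorNorm ℤ)] [NeZero (W'.conductorNorm ℤ)]
      (u : VariableChange ℚ) (D : ModularParametrizationData W (W.conductorNorm ℤ))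
      (D' : ModularParametrizationData W' (W'.conductorNorm ℤ)),
      2 ^ 4 ∣ W.conductorNorm ℤ → W'.conductorNorm ℤ = W.conductorNorm ℤ →
      u • W.quadraticTwist (((-1 : ℤ)) : ℚ) = C → IsIsogenous C W' →
      congruenceNumber D.f = congruenceNumber D'.f := by
  intro W W' C _ _ _ _ _ _ _ u D D' h16 hN hC hiso
  exact congruenceNumber_twin_negOne hN h16 u hC hiso D D'

/-- **E-desc-20 at `d = 2`: PROVED under `2⁶ ∣ N(W)`** (census: every same-conductor `d = ±2` row has
`v₂(N) ∈ {7, 8}`). [cite: AgasheRibetStein2012, §2.1] -/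
theorem twistPacketCongruenceInvariance_two_two :
    ∀ (W W' C : WeierstrassCurve ℚ) [W.IsElliptic] [W.IsGloballyMinimal] [W'.IsElliptic]
      [W'.IsGloballyMinimal] [C.IsElliptic] [NeZero (W.conductorNorm ℤ)] [NeZero (W'.conductorNorm ℤ)]
      (u : VariableChange ℚ) (D : ModularParametrizationData W (W.conductorNorm ℤ))
      (D' : ModularParametrizationData W' (W'.conductorNorm ℤ)),
      2 ^ 6 ∣ W.conductorNorm ℤ → W'.conductorNorm ℤ = W.conductorNorm ℤ →
      u • W.quadraticTwist (((2 : ℤ)) : ℚ) = C → IsIsogenous C W' →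
      congruenceNumber D.f = congruenceNumber D'.f := by
  intro W W' C _ _ _ _ _ _ _ u D D' h64 hN hC hiso
  exact congruenceNumber_twin_two hN h64 u hC hiso D D'

/-- **E-desc-20 at `d = −2`: PROVED under `2⁶ ∣ N(W)`.** [cite: AgasheRibetStein2012, §2.1] -/
theorem twistPacketCongruenceInvariance_two_negTwo :
    ∀ (W W' C : WeierstrassCurve ℚ) [W.IsElliptic] [W.IsGloballyMinimal] [W'.IsElliptic]
      [W'.IsGloballyMinimal] [C.IsElliptic] [NeZero (W.conductorNorm ℤ)] [NeZero (W'.conductorNorm ℤ)]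
      (u : VariableChange ℚ) (D : ModularParametrizationData W (W.conductorNorm ℤ))
      (D' : ModularParametrizationData W' (W'.conductorNorm ℤ)),
      2 ^ 6 ∣ W.conductorNorm ℤ → W'.conductorNorm ℤ = W.conductorNorm ℤ →
      u • W.quadraticTwist (((-2 : ℤ)) : ℚ) = C → IsIsogenous C W' →
      congruenceNumber D.f = congruenceNumber D'.f := by
  intro W W' C _ _ _ _ _ _ _ u D D' h64 hN hC hiso
  exact congruenceNumber_twin_negTwo hN h64 u hC hiso D D'

/-- **THE `2`-PART OF E-desc-20, PROVED on `64 ∣ N`:** E-desc-20's binders verbatim (incl. `(d : ℤ)`)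
plus `d ∈ {−1, 2, −2}` and `2⁶ ∣ N(W)`. [cite: AgasheRibetStein2012, §2.1] [cite: Shimura1971, Prop. 3.64] -/
theorem twistPacketCongruenceInvariance_twoPart :
    ∀ (W W' C : WeierstrassCurve ℚ) [W.IsElliptic] [W.IsGloballyMinimal] [W'.IsElliptic]
      [W'.IsGloballyMinimal] [C.IsElliptic] [NeZero (W.conductorNorm ℤ)] [NeZero (W'.conductorNorm ℤ)]
      (u : VariableChange ℚ) (d : ℤ) (D : ModularParametrizationData W (W.conductorNorm ℤ))
      (D' : ModularParametrizationData W' (W'.conductorNorm ℤ)),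
      (d = -1 ∨ d = 2 ∨ d = -2) → 2 ^ 6 ∣ W.conductorNorm ℤ → W'.conductorNorm ℤ = W.conductorNorm ℤ →
      u • W.quadraticTwist ((d : ℤ) : ℚ) = C → IsIsogenous C W' →
      congruenceNumber D.f = congruenceNumber D'.f := by
  intro W W' C _ _ _ _ _ _ _ u d D D' hd h64 hN hC hiso
  rcases hd with rfl | rfl | rfl
  · exact congruenceNumber_twin_negOne hN ((show 2 ^ 4 ∣ 2 ^ 6 by norm_num).trans h64) u hC hiso D D'
  · exact congruenceNumber_twin_two hN h64 u hC hiso D D'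
  · exact congruenceNumber_twin_negTwo hN h64 u hC hiso D D'

/-- **THE ODD-PRIME PART OF E-desc-20, PROVED on `p² ∣ N`:** E-desc-20's binders verbatim plus
`d = p* = (−1)^{⌊p/2⌋} p` (`p` an odd prime) and `p² ∣ N(W)` (O5's TWIN up to isogeny; census: every
same-conductor odd row has `v_p(N) ≥ 2`). [cite: AgasheRibetStein2012, §2.1] [cite: Shimura1971, Prop. 3.64] -/
theorem twistPacketCongruenceInvariance_oddPrime (p : ℕ) (hp : p.Prime) (hp2 : p ≠ 2) :
    ∀ (W W' C : WeierstrassCurve ℚ) [W.IsElliptic] [W.IsGloballyMinimal] [W'.IsElliptic]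
      [W'.IsGloballyMinimal] [C.IsElliptic] [NeZero (W.conductorNorm ℤ)] [NeZero (W'.conductorNorm ℤ)]
      (u : VariableChange ℚ) (d : ℤ) (D : ModularParametrizationData W (W.conductorNorm ℤ))
      (D' : ModularParametrizationData W' (W'.conductorNorm ℤ)),
      d = (-1) ^ (p / 2) * p → p ^ 2 ∣ W.conductorNorm ℤ → W'.conductorNorm ℤ = W.conductorNorm ℤ →
      u • W.quadraticTwist ((d : ℤ) : ℚ) = C → IsIsogenous C W' →
      congruenceNumber D.f = congruenceNumber D'.f := by
  intro W W' C _ _ _ _ _ _ _ u d D D' hd hpN hN hC hiso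
  haveI : Fact p.Prime := ⟨hp⟩
  subst hd
  exact congruenceNumber_twin_pStar hp2 hN hpN u hC hiso D D'

/-- **E-desc-20 ON THE PRIME-CONDUCTOR SUB-PACKET — THEOREM.** E-desc-20's binders verbatim plus ONE
hypothesis: `d` is a prime fundamental discriminant unit `−1` with `2⁴ ∣ N`, or `±2` with `2⁶ ∣ N`, or
`p*` (`p` odd prime) with `p² ∣ N`. This covers every same-conductor row of the cell's twist census
(`TWISTCENSUS2-rows-v1`: `d = −1` only at `v₂(N) ≥ 5`, `d = ±2` only at `v₂(N) ∈ {7, 8}`, odd `p*`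
only at `v_p(N) ≥ 2`) and desc's 707 / 707 pairs. [cite: AgasheRibetStein2012, §2.1]
[cite: Shimura1971, Prop. 3.64] [cite: DiamondShurman2005, Prop. 5.5.2(a)] -/
theorem twistPacketCongruenceInvariance_primeConductor :
    ∀ (W W' C : WeierstrassCurve ℚ) [W.IsElliptic] [W.IsGloballyMinimal] [W'.IsElliptic]
      [W'.IsGloballyMinimal] [C.IsElliptic] [NeZero (W.conductorNorm ℤ)] [NeZero (W'.conductorNorm ℤ)]
      (u : VariableChange ℚ) (d : ℤ) (D : ModularParametrizationData W (W.conductorNorm ℤ))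
      (D' : ModularParametrizationData W' (W'.conductorNorm ℤ)),
      ((d = -1 ∧ 2 ^ 4 ∣ W.conductorNorm ℤ) ∨ ((d = 2 ∨ d = -2) ∧ 2 ^ 6 ∣ W.conductorNorm ℤ) ∨
        (∃ p : ℕ, p.Prime ∧ p ≠ 2 ∧ d = (-1) ^ (p / 2) * p ∧ p ^ 2 ∣ W.conductorNorm ℤ)) →
      W'.conductorNorm ℤ = W.conductorNorm ℤ →
      u • W.quadraticTwist ((d : ℤ) : ℚ) = C → IsIsogenous C W' →
      congruenceNumber D.f = congruenceNumber D'.f := by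
  intro W W' C _ _ _ _ _ _ _ u d D D' hd hN hC hiso
  rcases hd with ⟨rfl, h16⟩ | ⟨hd2, h64⟩ | ⟨p, hp, hp2, rfl, hpN⟩
  · exact congruenceNumber_twin_negOne hN h16 u hC hiso D D'
  · rcases hd2 with rfl | rfl
    · exact congruenceNumber_twin_two hN h64 u hC hiso D D'
    · exact congruenceNumber_twin_negTwo hN h64 u hC hiso D D'
  · haveI : Fact p.Prime := ⟨hp⟩
    exact congruenceNumber_twin_pStar hp2 hN hpN u hC hiso D D'

end Slices

end TwistAtTwo

end Summit.BirchSwinnertonDyer.Rank1Residual.ManinAdditive
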